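import Literature.AlgebraicGeometry.Motives.AbelianVarietyQuotientMap
import Literature.AlgebraicGeometry.RelativeSpec.FreeQuotientKernelPair
import Literature.AlgebraicGeometry.Morphisms.FlatOfComp
import Literature.AlgebraicGeometry.Morphisms.ReducedOfFlat
import HarnessLib

/-!
# The quotient map `h : P ⟶ P/S` is flat; `P ×_{P/S} P` is reduced; `P/S` is geometrically integral and proper

Continuation of `AbelianVarietyQuotientMap`. With the notation there (`Y = P ×_K Spec L`,
`G = S ⋊ Aut(L/K)` acting freely on `Y` over `P`, `P/S := Y/G`, `π : Y → P/S`, `h : P → P/S` with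
`pr ≫ h = π`):

* `flat_quotientMap`: **`h` is flat** — `π` is flat (free action, Chase–Harrison–Rosenberg) and
  `pr : Y → P` is flat and surjective, and flatness descends along flat surjective maps on the
  source (`Literature.AlgebraicGeometry.Morphisms.Flat.of_comp_of_surjective`, Stacks 02JZ). With
  `surjective_quotientMap` and `quasiCompact_quotientMap`, `h` is an fpqc covering, hence an
  effective epimorphism of schemes (Mathlib), along which the group law will be descended;
* `isReduced_pullback_quotientMap`: **the kernel pair `P ×_{P/S} P` of `h` is reduced** — it
  receives the flat surjective morphism `pr × pr` from `Y ×_{Y/G} Y`, which is reduced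
  (`ActionOver.isReduced_pullback_toQuotient`), and reducedness descends
  (`isReduced_of_flat_of_surjective`).

* `quotOver`, `quotientMapOver`: `P/S` and `h` over `Spec K`; `geometricallyIntegral_quotOver`
  (after a base field extension, the base change of `h` is flat surjective from the integral
  `P_{K'}`, so `(P/S)_{K'}` is reduced and irreducible) and `isProper_quotOver` (`P/S → P` finite).

Mumford, *Abelian Varieties*, §7 (Thm. p. 66, Thm. 4 p. 72), §12; Görtz–Wedhorn II, Thm. 27.68.

## References

* [MumfordAV1970] D. Mumford, *Abelian Varieties* (1970), §7, §12.
* [StacksProject, Tag 02JZ], [Tag 033E].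
-/

noncomputable section

universe u

open CategoryTheory CategoryTheory.Limits AlgebraicGeometry

namespace Literature.AlgebraicGeometry.Motives

namespace AbelianVariety

open scoped MonObj Obj
open Literature.AlgebraicGeometry.RelativeSpec Literature.AlgebraicGeometry.Morphisms

variable {K : Type u} [Field K] (L : Type u) [Field L] [Algebra K L] (P : AbelianVariety K)
variable (S : Subgroup (P.Points L))
  (hS : ∀ (σ : L ≃ₐ[K] L) (s : P.Points L), s ∈ S → σ • s ∈ S)
  (q : P ⟶ P) (hSq : ∀ s ∈ S, s ≫ q.hom.hom.hom = 1)

/-! ### The projection `pr : Y = P_L → P` is flat and surjective -/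

/-- `Spec L → Spec K` is flat. [folklore] -/
instance flat_bcSpec : Flat (bcSpec K L) := by
  rw [HasRingHomProperty.Spec_iff (P := @Flat)]
  change (algebraMap K L).Flat
  rw [RingHom.flat_algebraMap_iff]
  infer_instance

/-- `Spec L → Spec K` is surjective. [folklore] -/
instance surjective_bcSpec : Surjective (bcSpec K L) :=
  ⟨fun _ ↦ ⟨Classical.arbitrary _, Subsingleton.elim _ _⟩⟩

/-- `pr : Y → P` is flat. [folklore] -/
instance flat_fst : Flat (pullback.fst P.X.hom (bcSpec K L)) :=
  MorphismProperty.pullback_fst _ _ inferInstance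

/-- `pr : Y → P` is surjective. [folklore] -/
instance surjective_fst : Surjective (pullback.fst P.X.hom (bcSpec K L)) :=
  MorphismProperty.pullback_fst _ _ inferInstance

/-- `Y = P ×_K Spec L` is reduced (indeed integral, `P_L` being an abelian variety over `L`).
[folklore] -/
instance isReduced_bcLeft : IsReduced (P.bcLeft L) :=
  inferInstanceAs (IsReduced (P.baseChange L).X.left)

variable [FiniteDimensional K L] [IsGalois K L] [Finite S] [IsAffineHom (Hom.toSchemeHom q)]

/-! ### `h` is flat; `P ×_{P/S} P` is reduced -/

/-- **`h : P ⟶ P/S` is flat**: `pr ≫ h = π` is flat (`ActionOver.flat_toQuotient`, the action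
being free) and `pr` is flat and surjective (`Flat.of_comp_of_surjective`). [folklore] -/
theorem flat_quotientMap : Flat (P.quotientMap L S hS q hSq) := by
  have : Flat (pullback.fst P.X.hom (bcSpec K L) ≫ P.quotientMap L S hS q hSq) := by
    rw [fst_quotientMap]
    exact (P.quotAction L S hS q hSq).flat_toQuotient fun U g hg ↦
      P.quotAction_free L S hS q hSq U g hg
  exact Flat.of_comp_of_surjective (pullback.fst P.X.hom (bcSpec K L)) _

/-- `h` is quasi-compact (it is affine: `h ≫ (P/S → P) = q`). [folklore] -/
instance quasiCompact_quotientMap : QuasiCompact (P.quotientMap L S hS q hSq) := by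
  apply MorphismProperty.of_postcomp (W := @QuasiCompact) (W' := @QuasiSeparated) _
    (P.quotAction L S hS q hSq).quotientToBase
  · infer_instance
  · rw [quotientMap_quotientToBase]
    infer_instance

/-- **`P ×_{P/S} P` is reduced**: it receives the flat surjective map `pr × pr` from
`Y ×_{Y/G} Y`, which is reduced (`ActionOver.isReduced_pullback_toQuotient`).
[folklore] -/
theorem isReduced_pullback_quotientMap :
    IsReduced (pullback (P.quotientMap L S hS q hSq) (P.quotientMap L S hS q hSq)) := by
  set ρ := P.quotAction L S hS q hSq with hρ
  haveI : IsReduced (pullback ρ.toQuotient ρ.toQuotient) :=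
    ρ.isReduced_pullback_toQuotient fun U g hg ↦ P.quotAction_free L S hS q hSq U g hg
  have e : ρ.toQuotient = pullback.fst P.X.hom (bcSpec K L) ≫ P.quotientMap L S hS q hSq :=
    (P.fst_quotientMap L S hS q hSq).symm
  haveI : Flat (P.quotientMap L S hS q hSq) := P.flat_quotientMap L S hS q hSq
  have hflat := MorphismProperty.pullbackMap (P := @Flat)
    (f := ρ.toQuotient) (g := ρ.toQuotient) (f' := P.quotientMap L S hS q hSq)
    (g' := P.quotientMap L S hS q hSq) (i₁ := pullback.fst P.X.hom (bcSpec K L))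
    (i₂ := pullback.fst P.X.hom (bcSpec K L)) inferInstance inferInstance e e
  have hsurj := MorphismProperty.pullbackMap (P := @Surjective)
    (f := ρ.toQuotient) (g := ρ.toQuotient) (f' := P.quotientMap L S hS q hSq)
    (g' := P.quotientMap L S hS q hSq) (i₁ := pullback.fst P.X.hom (bcSpec K L))
    (i₂ := pullback.fst P.X.hom (bcSpec K L)) inferInstance inferInstance e e
  haveI := hflat
  haveI := hsurj
  exact isReduced_of_flat_of_surjective (pullback.map ρ.toQuotient ρ.toQuotient
    (P.quotientMap L S hS q hSq) (P.quotientMap L S hS q hSq)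
    (pullback.fst P.X.hom (bcSpec K L)) (pullback.fst P.X.hom (bcSpec K L)) (𝟙 _)
    ((Category.comp_id _).trans e) ((Category.comp_id _).trans e))


/-! ### `P/S` as a `K`-scheme; geometric integrality -/

/-- **`P/S` as a `K`-scheme**, with structure map `P/S → P → Spec K`. [folklore] -/
abbrev quotOver : SchemeOver K :=
  Over.mk ((P.quotAction L S hS q hSq).quotientToBase ≫ P.X.hom)

/-- `P → Spec K` factors as `h ≫ (P/S → Spec K)`. [folklore] -/
theorem quotientMap_comp_hom :
    P.quotientMap L S hS q hSq ≫ (P.quotOver L S hS q hSq).hom = P.X.hom := by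
  change P.quotientMap L S hS q hSq ≫ (P.quotAction L S hS q hSq).quotientToBase ≫ P.X.hom = _
  rw [quotientMap_quotientToBase_assoc]
  exact Over.w q.hom.hom.hom

/-- **`h : P ⟶ P/S` as a morphism of `K`-schemes.** [folklore] -/
def quotientMapOver : P.X ⟶ P.quotOver L S hS q hSq :=
  Over.homMk (P.quotientMap L S hS q hSq) (P.quotientMap_comp_hom L S hS q hSq)

/-- `quotientMapOver` on underlying schemes is `h`. [folklore] -/
@[simp]
theorem quotientMapOver_left :
    (P.quotientMapOver L S hS q hSq).left = P.quotientMap L S hS q hSq := rfl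

/-- **`P/S` is geometrically integral over `K`**: after any base field extension `K'/K`, the
base change of `h`, `P_{K'} → (P/S)_{K'}`, is flat and surjective with `P_{K'}` integral, so
`(P/S)_{K'}` is reduced (`isReduced_of_flat_of_surjective`) and irreducible (as the image of
`P_{K'}`). [folklore] -/
theorem geometricallyIntegral_quotOver :
    GeometricallyIntegral (P.quotOver L S hS q hSq).hom := by
  refine ⟨fun K' _ y Z fst' snd' hpb ↦ ?_⟩
  haveI : Flat (P.quotientMap L S hS q hSq) := P.flat_quotientMap L S hS q hSq
  haveI : Surjective (P.quotientMap L S hS q hSq) := P.surjective_quotientMap L S hS q hSq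
  have e : P.X.hom = P.quotientMap L S hS q hSq ≫ (P.quotOver L S hS q hSq).hom :=
    (P.quotientMap_comp_hom L S hS q hSq).symm
  let m := pullback.map P.X.hom y (P.quotOver L S hS q hSq).hom y (P.quotientMap L S hS q hSq)
    (𝟙 _) (𝟙 _) ((Category.comp_id _).trans e) ((Category.comp_id _).trans (Category.id_comp _).symm)
  have hflat : Flat m := MorphismProperty.pullbackMap (P := @Flat) (i₂ := 𝟙 _)
    ‹Flat (P.quotientMap L S hS q hSq)› inferInstance e (Category.id_comp _).symm
  have hsurj : Surjective m := MorphismProperty.pullbackMap (P := @Surjective) (i₂ := 𝟙 _)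
    ‹Surjective (P.quotientMap L S hS q hSq)› inferInstance e (Category.id_comp _).symm
  -- `P_{K'}` is integral
  haveI : IsIntegral (pullback P.X.hom y) :=
    GeometricallyIntegral.isIntegral_of_subsingleton (pullback.snd P.X.hom y)
  haveI : IsReduced (pullback (P.quotOver L S hS q hSq).hom y) := isReduced_of_flat_of_surjective m
  haveI : IrreducibleSpace ↥(pullback (P.quotOver L S hS q hSq).hom y) :=
    m.surjective.irreducibleSpace m.continuous
  -- transport to the given pullback `Z`
  let e := hpb.isoPullback
  haveI : IsReduced Z := isReduced_of_isOpenImmersion e.hom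
  haveI : IrreducibleSpace ↥Z := e.inv.surjective.irreducibleSpace e.inv.continuous
  exact isIntegral_of_irreducibleSpace_of_isReduced _

omit [IsGalois K L] in
/-- `P/S → Spec K` is proper: `P/S → P` is finite (the invariants are finite over the noetherian
`P`, `ActionOver.isFinite_quotientToBase`) and `P → Spec K` is proper. [folklore] -/
theorem isProper_quotOver (hq : IsFinite (Hom.toSchemeHom q)) :
    IsProper (P.quotOver L S hS q hSq).hom := by
  haveI : IsLocallyNoetherian P.X.left := LocallyOfFiniteType.isLocallyNoetherian P.X.hom
  haveI : IsFinite (P.quotR L q) := by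
    haveI : IsFinite (bcSpec K L) := by
      rw [IsFinite.SpecMap_iff]
      change (algebraMap K L).Finite
      rw [RingHom.finite_algebraMap]
      infer_instance
    haveI : IsFinite (pullback.fst P.X.hom (bcSpec K L)) :=
      MorphismProperty.pullback_fst _ _ inferInstance
    exact inferInstanceAs (IsFinite (pullback.fst P.X.hom (bcSpec K L) ≫ Hom.toSchemeHom q))
  haveI : IsFinite (P.quotAction L S hS q hSq).quotientToBase :=
    (P.quotAction L S hS q hSq).isFinite_quotientToBase
  change IsProper ((P.quotAction L S hS q hSq).quotientToBase ≫ P.X.hom)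
  infer_instance

end AbelianVariety

end Literature.AlgebraicGeometry.Motives
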